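import Literature.AnabelianGeometry.EtaleTheta.Discharge.Sec4NonVacuityCoveringZ
import Literature.AnabelianGeometry.EtaleTheta.Discharge.Sec4NonVacuityCoveringRoots
import Literature.AnabelianGeometry.EtaleTheta.Discharge.Sec4Prop42SubBaseLiftUpToUnit
import Literature.AnabelianGeometry.EtaleTheta.Discharge.Sec4Prop42SubRefinement
import Literature.AnabelianGeometry.EtaleTheta.Discharge.Sec4Prop42SubZetaA
import Literature.AnabelianGeometry.EtaleTheta.Discharge.Sec4NonVacuityPipeline
import HarnessLib

/-!
# [EtTh] §4 with a COVERING, integral exponents: roots exist ONLY upstairs, and Prop 4.2 (iii) still FIRES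
# (consistency witness, part 7 — the closers at `ToyCovZ`)

S. Mochizuki, *The étale theta function and its Frobenioid-theoretic manifestations*, Publ. RIMS **45**
(2009) [MochizukiEtTh2009], §4, Prop 4.2 pp.88–90 (PDF), Prop 4.3 (ii)(iii) pp.90–91; sub-DAG
`plan/L2/SUBDAG-EtTh-Prop42.md` (L01a — ERRATUM E2 —, L01b, L01′, L02, L03′, L04, L05).

CONSISTENCY WITNESS, TOY — joint satisfiability; consistency ≠ faithfulness.  Sequel of
`Sec4NonVacuityCoveringZ.lean` (the integral Kummer-tower toy `ToyCovZ`: `B = ℂˣ × t^ℤ`) and the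
integral-exponent twin of `Sec4NonVacuityCoveringRoots.lean` (p428415, `ToyCov`: `B = ℂˣ × (ℚ_{≥0})^gp`).  The point
of the variant: **`ToyCovZ.roots_only_upstairs`** — the uniformiser `t ∈ O^×(A_⊙^birat)` has NO square root,
while its pull-back `t²` along the pull-back morphism `(1, t ↦ t², 0, 1) : A_⊙ → A_⊙` over the degree-`2` Kummer
cover has one; nevertheless the covering input L01a / L01′ HOLDS (`rootOverCovering`,
`saturatedRootCoverInSkeleton`: the root of `f = c·t^n` upstairs is `c^{1/N}·t^n`, since `f` pulls back to
`c·t^{Nn}`), L01b fires, and **the typed Prop 4.2 (iii) HOLDS** (`prop42_iii`, by abc-iut-w5-d134's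
`prop42_iii_mkOfModelCanonical_of_inSkeleton`), together with (i)(ii)(iv) and Prop 4.3 (ii)(iii)
(`sec4_props_roots_upstairs`; the intermediate steps are `private` here because they print exactly like their `ToyCov` twins).  So in the kernel: at a setting where `N`-th roots are NOT available in
`O^×(A_⊙^birat)`, Prop 4.2 (iii) is obtained EXACTLY through the passage to a covering — the rendering of
ERRATUM E2 asked for by abc-iut-L2-lead's row «§4 TOY WITH A COVERING» (R75); compare `Toy.not_prop42_iii`
(p422428: no covers, (iii) fails) and `ToyCov` (p428415: divisible exponents).  PROOF-ONLY.

HONEST LIMITS: one base object; `B` is not a [FrdI] monoid on the collapsed base (pull-back along a cover is not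
surjective on `t^ℤ`), so "`C` is a Frobenioid" and Thm 4.4 (i)/(iii) are not available for `ToyCovZ` (they are
for `ToyCov`, p428819); trivial [FrdI] vocabularies; `(N,H)`-slot `True`; `Π^tp` trivial over `ℚ̄`; not a curve;
typed ≠ proved.  Nothing here bears on, or takes a side on, [IUTchIII] Cor. 3.12.
-/

noncomputable section

namespace Literature.AnabelianGeometry.EtaleTheta

open CategoryTheory Opposite Literature.AlgebraicGeometry.Frobenioids
open scoped NNRat

namespace ToyCovZ

open ToyCov (Base pt deg cover deg_cover hom_eq aut_eq_one epi catVocab powFunctor powFunctor_map_apply)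

section Roots

/-- On groupifications the `N`-th power map induces the `N`-th power map. [folklore] -/
private theorem gpMap_powMonoidHom' (M : Type) [CommMonoid M] (N : ℕ) :
    gpMap (powMonoidHom N : M →* M) = powMonoidHom N := by
  apply Algebra.GrothendieckGroup.lift.symm.injective
  rw [Algebra.GrothendieckGroup.lift_symm_apply, Algebra.GrothendieckGroup.lift_symm_apply]
  ext m
  change gpMap (powMonoidHom N) (Algebra.GrothendieckGroup.of m) = Algebra.GrothendieckGroup.of m ^ N
  rw [gpMap_of, powMonoidHom_apply, map_pow]

/-- `ℂˣ` is divisible: every constant has an `N`-th root. [folklore] -/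
private theorem exists_pow_eq_units (c : ℂˣ) (N : ℕ+) : ∃ c' : ℂˣ, c' ^ (N : ℕ) = c := by
  obtain ⟨z, hz⟩ := IsAlgClosed.exists_pow_nat_eq (c : ℂ) (PNat.pos N)
  have hu : IsUnit z := (isUnit_pow_iff (PNat.ne_zero N)).mp (hz ▸ c.isUnit)
  exact ⟨hu.unit, Units.ext (by simp [hz])⟩

/-- Pull-back of divisors along the degree-`N` cover is the `N`-th power map, also on `Φ(∗)^gp`.
[cite: MochizukiEtTh2009, Def 3.3 p.73] -/
private theorem gpMap_pull_cover (N : ℕ+) (ξ : Algebra.GrothendieckGroup (temperedFrobenioid.Φ.carrier (op Aodot.base))) :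
    gpMap (temperedFrobenioid.Φ.pull (cover Aodot.base Aodot.base N).op) ξ = ξ ^ (N : ℕ) := by
  have h : temperedFrobenioid.Φ.pull (cover Aodot.base Aodot.base N).op = powMonoidHom (N : ℕ) :=
    MonoidHom.ext fun x => Subtype.ext rfl
  rw [h, gpMap_powMonoidHom']
  rfl

/-- The relation of the model Frobenioid for the data `(1, cover N, 0, 1)` at `A_⊙ = (∗, 0)`.
[cite: MochizukiFrdI2008, Thm. 5.2(i) p.100] -/
private theorem cover_rel (N : ℕ+) :
    Aodot.cls ^ ((1 : ℕ+) : ℕ) * Algebra.GrothendieckGroup.of (1 : temperedFrobenioid.divisorMonoid.obj (op Aodot.base)) =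
      pullGp temperedFrobenioid.divisorMonoid (cover Aodot.base Aodot.base N) Aodot.cls *
        divB temperedFrobenioid.divisorMonoid temperedFrobenioid.ratFnFunctor temperedFrobenioid.divBNatTrans
          (op Aodot.base) 1 := by
  simp only [PNat.one_coe, pow_one, map_one, mul_one]
  exact (map_one _).symm

/-- **The root upstairs**: along the pull-back morphism `φ_N = (1, t ↦ t^N, 0, 1)` over the degree-`N`
Kummer cover, `f = c·t^n` pulls back to `c·t^{Nn}`, which is the `N`-th power of `c^{1/N}·t^n` (`ℂˣ` is
divisible). [cite: MochizukiEtTh2009, Prop 4.2 p.89] -/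
private theorem exists_pow_eq_pullFracModel_cover (N : ℕ+) (f : temperedFrobenioid.biratUnitsModel Aodot) :
    ∃ g : temperedFrobenioid.biratUnitsModel Aodot, g ^ (N : ℕ) =
      temperedFrobenioid.pullFracModel
        (ModelFrobenioid.mkHom Aodot Aodot 1 (cover Aodot.base Aodot.base N) 1 1 (cover_rel N)) f := by
  let v : temperedFrobenioid.ratFnFunctor.obj (op Aodot.base) := Units.val f
  obtain ⟨c', hc'⟩ := exists_pow_eq_units v.1.1.1 N
  let g₀ : temperedFrobenioid.ratFnFunctor.obj (op Aodot.base) := ⟨((c', v.1.1.2), v.1.2), v.2⟩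
  refine ⟨(temperedFrobenioid.isUnit_ratFnFunctor realified.isUnit_BΛ Aodot g₀).unit, Units.ext ?_⟩
  rw [Units.val_pow_eq_pow_val, IsUnit.unit_spec, TemperedFrobenioid.coe_pullFracModel_apply]
  apply Subtype.ext
  change ((c', v.1.1.2), v.1.2) ^ (N : ℕ) = (temperedFrobenioid.ratFnPull (cover Aodot.base Aodot.base N).op v).1
  rw [TemperedFrobenioid.coe_ratFnPull, Prod.pow_mk, Prod.pow_mk, hc', gpMap_pull_cover]
  rfl

/-- `A_⊙ = (∗, 0)` is `H_⊙`-ample (`Aut_D(∗) = 1`). [cite: MochizukiEtTh2009, Def 4.1 p.87] -/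
private theorem isAmple_Aodot : biKummerSetting.IsAmple Aodot :=
  ⟨trivial, fun σ _ => ⟨1, by rw [map_one, aut_eq_one _ σ]⟩⟩

/-- Every automorphism of `A_⊙` fixes every birational unit (all automorphisms are units, and units act
trivially on `O^×(A^birat)`). [cite: MochizukiEtTh2009, Def 4.1 p.87] -/
private theorem isFixedByHA_Aodot (f : biKummerSetting.biratUnits Aodot) :
    biKummerSetting.IsFixedByHA Aodot trivial f := fun σ _ => by
  change temperedFrobenioid.biratAutModel Aodot σ f = f
  rw [temperedFrobenioid.biratAutModel_eq_one_of_mem_units ((mem_units_and_unitsToRatFn_injective Aodot).1 σ)]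
  rfl

/-- **L01′ `SaturatedRootCoverInSkeleton` HOLDS at the integral Kummer-tower toy** — the covering input of
Prop 4.2 (iii) (ERRATUM E2), supplied by the KUMMER COVER: for `N` and `f = c·t^n ∈ O^×(A_⊙^birat)`, the
pull-back morphism `φ_N := (1, t ↦ t^N, 0, 1) : A_⊙ → A_⊙` over the degree-`N` cover pulls `f` back to
`c·t^{Nn} = (c^{1/N}·t^n)^N`, and `A_⊙` is Frobenius-trivial, Galois, `μ_N`-saturated (REAL) and
`(N, H_⊙, f|)`-saturated. [cite: MochizukiEtTh2009, Prop 4.2 p.89] -/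
private theorem saturatedRootCoverInSkeleton :
    BiKummerSetting.Prop42Sub.SaturatedRootCoverInSkeleton biKummerSetting
      (fun {_ _} φ x => temperedFrobenioid.pullFracModel φ x) := by
  intro N f
  refine ⟨Aodot, ModelFrobenioid.mkHom Aodot Aodot 1 (cover Aodot.base Aodot.base N) 1 1 (cover_rel N), fun _ => rfl,
    ModelFrobenioid.isPullbackMorphism_of divisorMonoid_isDivisorial ratFnFunctor_isGroupLike rfl rfl,
    isFrobeniusTrivial_Aodot, trivial, isMuSaturated Aodot N, isAmple_Aodot, isFixedByHA_Aodot _,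
    ⟨Aodot, Aodot, 𝟙 _, 𝟙 _, ModelFrobenioid.isPreStep_id _, ModelFrobenioid.isPreStep_id _,
      isFrobeniusTrivial_Aodot, trivial⟩, ?_⟩
  exact exists_pow_eq_pullFracModel_cover N f

/-- **L01a `RootOverCovering` HOLDS at the integral Kummer-tower toy** (the covering input, ERRATUM E2).
[cite: MochizukiEtTh2009, Prop 4.2 p.89] -/
private theorem rootOverCovering :
    BiKummerSetting.Prop42Sub.RootOverCovering biKummerSetting
      (fun {_ _} φ x => temperedFrobenioid.pullFracModel φ x) := fun N f => by
  obtain ⟨A', φ, -, hφ, hft, hG, hμ, hsat⟩ := saturatedRootCoverInSkeleton N f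
  exact ⟨A', φ, hφ, hft, hG, hμ, hsat.cond_b⟩

/-- In `ℚ_{≥0}` (written multiplicatively), `x ≤ y` gives `x ∣ y`. [folklore] -/
private theorem dvd_of_le' {x y : (⊤ : Submonoid (Multiplicative ℚ≥0))}
    (h : Multiplicative.toAdd x.1 ≤ Multiplicative.toAdd y.1) : x ∣ y := by
  obtain ⟨d, hd⟩ := exists_add_of_le h
  refine ⟨⟨Multiplicative.ofAdd d, trivial⟩, Subtype.ext ?_⟩
  change y.1 = x.1 * Multiplicative.ofAdd d
  apply Multiplicative.toAdd.injective
  rw [toAdd_mul, toAdd_ofAdd, hd]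

/-- Coprime elements of the totally ordered sharp monoid `ℚ_{≥0}`: one of them is `0`. [folklore] -/
private theorem coprime_cases {a b : (⊤ : Submonoid (Multiplicative ℚ≥0))}
    (h : ∀ x : (⊤ : Submonoid (Multiplicative ℚ≥0)), x ∣ a → x ∣ b → x = 1) : a = 1 ∨ b = 1 := by
  rcases le_total (Multiplicative.toAdd a.1) (Multiplicative.toAdd b.1) with hab | hba
  · exact Or.inl (h a (dvd_refl a) (dvd_of_le' hab))
  · exact Or.inr (h b (dvd_of_le' hba) (dvd_refl b))

/-- The [FrdI] Prop 4.1 (iii) coprimality predicate pulls back along every base morphism (`Φ = ℚ_{≥0}`: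
"coprime" means "one of the two is `0`"). [cite: MochizukiEtTh2009, Prop 4.2 p.89] -/
private theorem coprime_pull {A A' : Base} (e : A' ⟶ A) {a b : temperedFrobenioid.Φ.carrier (op A)}
    (h : ∀ x : temperedFrobenioid.Φ.carrier (op A), x ∣ a → x ∣ b → x = 1)
    (y : temperedFrobenioid.Φ.carrier (op A')) (hya : y ∣ pull temperedFrobenioid.divisorMonoid e a)
    (hyb : y ∣ pull temperedFrobenioid.divisorMonoid e b) : y = 1 := by
  rcases coprime_cases h with ha | hb
  · have h1 : pull temperedFrobenioid.divisorMonoid e a = 1 := by rw [ha]; exact map_one _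
    rw [h1] at hya
    exact (divisorMonoid_isDivisorial A').isSharp.eq_one_of_isUnit y (isUnit_of_dvd_one hya)
  · have h1 : pull temperedFrobenioid.divisorMonoid e b = 1 := by rw [hb]; exact map_one _
    rw [h1] at hyb
    exact (divisorMonoid_isDivisorial A').isSharp.eq_one_of_isUnit y (isUnit_of_dvd_one hyb)

/-- **[EtTh] Prop 4.2 (iii) HOLDS at the integral Kummer-tower toy**, BY THE SUB-DAG: abc-iut-w5-d134's
`prop42_iii_mkOfModelCanonical_of_inSkeleton` (composition `prop42_iii_of_subnodes_upToUnit` of L01′ with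
the model-level L02 `rootFractionPair_mkOfModel`, L03′ `baseFrobeniusLiftUpToUnit_mkOfModelCanonical`,
L04 `rootSquares_mkOfModel`) FIRES on the covering input `saturatedRootCoverInSkeleton` — so the typed
(iii), FALSE at the cover-free toy (p422428), holds here although roots exist only upstairs: its sub-DAG inputs are jointly satisfiable.
[cite: MochizukiEtTh2009, Prop 4.2 p.88] -/
private theorem prop42_iii :
    biKummerSetting.Prop42_iii (fun {_ _} φ x => temperedFrobenioid.pullFracModel φ x) :=
  BiKummerSetting.Prop42Sub.prop42_iii_mkOfModelCanonical_of_inSkeleton Toy.temperedGroup temperedFrobenioid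
    temperedFrobenioid_monoidType temperedFrobenioid_isPerfect (fun _ => True) (fun _ _ => 1)
    ToyCov.galoisSurj_surjective (fun _ _ _ => True) Aodot isFrobeniusTrivial_Aodot trivial divisorMonoid_isDivisorial
    (fun e _ _ h y hya hyb => coprime_pull e h y hya hyb) saturatedRootCoverInSkeleton

/-- **L01b `SaturatedRefinement` FIRES at the integral Kummer-tower toy** through abc-iut-w4-d044's
`saturatedRefinement_mkOfModelCanonical_of_laws` (refinement `ψ = id`; REAL `μ_N`-saturation of every
object; trivial Galois surjections). [cite: MochizukiEtTh2009, Prop 4.2 p.90] -/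
private theorem saturatedRefinement :
    BiKummerSetting.Prop42Sub.SaturatedRefinement biKummerSetting
      (fun {_ _} φ x => temperedFrobenioid.pullFracModel φ x) :=
  BiKummerSetting.saturatedRefinement_mkOfModelCanonical_of_laws Toy.temperedGroup temperedFrobenioid
    temperedFrobenioid_monoidType temperedFrobenioid_isPerfect (fun _ => True) (fun _ _ => 1)
    ToyCov.galoisSurj_surjective (fun _ _ _ => True) Aodot isFrobeniusTrivial_Aodot trivial divisorMonoid_isDivisorial
    (fun N A' _ _ => ⟨A', 𝟙 A',
      ModelFrobenioid.isPullbackMorphism_of divisorMonoid_isDivisorial ratFnFunctor_isGroupLike rfl rfl, trivial,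
      isMuSaturated A' N, trivial⟩)
    (fun _ _ _ _ b => ⟨1, fun g => by
      rw [MonoidHom.one_apply, MonoidHom.one_apply]
      exact (Category.id_comp _).trans (Category.comp_id _).symm⟩)

/-- **L05 `UnitRootsUpstairs` HOLDS at the integral Kummer-tower toy**: every unit is multiplication by a constant
and `ℂˣ` is divisible. [cite: MochizukiEtTh2009, Prop 4.2 p.90] -/
private theorem unitRootsUpstairs :
    BiKummerSetting.Prop42Sub.UnitRootsUpstairs biKummerSetting
      (fun φ x => temperedFrobenioid.pullFracModel φ x) := by
  intro B f P N R x x' _ hx' _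
  let xu : ModelFrobenioid.units R.AN := ⟨x', hx'.1, hx'.2⟩
  obtain ⟨c, hc⟩ := exists_eq_cnstUnitHom R.AN xu
  obtain ⟨c', hc'⟩ := exists_pow_eq_units c N
  refine ⟨coefAut R.AN c', ⟨(coefAut_mem_units R.AN c').1, (coefAut_mem_units R.AN c').2⟩, ?_⟩
  have h : (coefUnit R.AN c') ^ (N : ℕ) = xu :=
    (mem_units_and_unitsToRatFn_injective R.AN).2 (by rw [map_pow, unitsToRatFn_coefUnit, ← map_pow, hc', hc])
  have h' := congrArg Subtype.val h
  rwa [SubmonoidClass.coe_pow] at h'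

/-- **Prop 4.2 (iv) HOLDS at the integral Kummer-tower toy** (abc-iut-w4-d044's
`prop42_iv_mkOfModelCanonical_of_unitRootsUpstairs`). [cite: MochizukiEtTh2009, Prop 4.2 p.89] -/
private theorem prop42_iv :
    biKummerSetting.Prop42_iv (fun φ x => temperedFrobenioid.pullFracModel φ x) :=
  BiKummerSetting.prop42_iv_mkOfModelCanonical_of_unitRootsUpstairs Toy.temperedGroup temperedFrobenioid
    temperedFrobenioid_monoidType temperedFrobenioid_isPerfect (fun _ => True) (fun _ _ => 1)
    ToyCov.galoisSurj_surjective (fun _ _ _ => True) Aodot isFrobeniusTrivial_Aodot trivial divisorMonoid_isDivisorial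
    unitRootsUpstairs

/-- **Prop 4.2 (i) and (ii) HOLD at the integral Kummer-tower toy** (abc-iut-L6-t12's `prop42_i_mkOfModel`,
`prop42_ii_mkOfModel` with `hDS := Toy.coprime_cancel`, `hDSι := coprime_pull`). [cite: MochizukiEtTh2009, Prop 4.2 p.88] -/
private theorem prop42_i_and_ii : biKummerSetting.Prop42_i ∧ biKummerSetting.Prop42_ii :=
  ⟨BiKummerSetting.prop42_i_mkOfModel Toy.temperedGroup temperedFrobenioid temperedFrobenioid_monoidType
    temperedFrobenioid_isPerfect realified.isUnit_BΛ
    (fun {A} a b => ∀ x : temperedFrobenioid.Φ.carrier A, x ∣ a → x ∣ b → x = 1) (fun _ => True)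
    (fun _ _ => 1) ToyCov.galoisSurj_surjective (fun _ _ _ => True)
    (fun {_ _} G α₂ α₁ => temperedFrobenioid.ArisesFromBaseFrobeniusPair G α₂ α₁) Aodot
    isFrobeniusTrivial_Aodot trivial divisorMonoid_isDivisorial
    (fun h h' e => Toy.coprime_cancel h h' e),
  BiKummerSetting.prop42_ii_mkOfModel Toy.temperedGroup temperedFrobenioid temperedFrobenioid_monoidType
    temperedFrobenioid_isPerfect realified.isUnit_BΛ
    (fun {A} a b => ∀ x : temperedFrobenioid.Φ.carrier A, x ∣ a → x ∣ b → x = 1) (fun _ => True)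
    (fun _ _ => 1) ToyCov.galoisSurj_surjective (fun _ _ _ => True)
    (fun {_ _} G α₂ α₁ => temperedFrobenioid.ArisesFromBaseFrobeniusPair G α₂ α₁) Aodot
    isFrobeniusTrivial_Aodot trivial divisorMonoid_isDivisorial
    (fun h h' e => Toy.coprime_cancel h h' e) (fun e _ _ _ h y hya hyb => coprime_pull e h y hya hyb)⟩

/-- **Prop 4.3 (ii) HOLDS at the integral Kummer-tower toy** (`prop43_ii_of`). [cite: MochizukiEtTh2009, Prop 4.3 p.90] -/
private theorem prop43_ii :
    biKummerSetting.Prop43_ii fun {_ _} φ => temperedFrobenioid.pullFracModel φ :=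
  biKummerSetting.prop43_ii_of divisorMonoid_isDivisorial ratFnFunctor_isGroupLike
    (fun {_ _} φ => temperedFrobenioid.pullFracModel φ)

/-- **Prop 4.3 (iii) HOLDS at the integral Kummer-tower toy** (`prop43_iii_mkOfModel`). [cite: MochizukiEtTh2009, Prop 4.3 p.91] -/
private theorem prop43_iii :
    biKummerSetting.Prop43_iii fun {_ _} φ => temperedFrobenioid.pullFracModel φ :=
  BiKummerSetting.prop43_iii_mkOfModel Toy.temperedGroup temperedFrobenioid temperedFrobenioid_monoidType
    temperedFrobenioid_isPerfect realified.isUnit_BΛ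
    (fun {A} a b => ∀ x : temperedFrobenioid.Φ.carrier A, x ∣ a → x ∣ b → x = 1) (fun _ => True)
    (fun _ _ => 1) ToyCov.galoisSurj_surjective (fun _ _ _ => True)
    (fun {_ _} G α₂ α₁ => temperedFrobenioid.ArisesFromBaseFrobeniusPair G α₂ α₁) Aodot
    isFrobeniusTrivial_Aodot trivial divisorMonoid_isDivisorial
    (fun {_ _} φ => temperedFrobenioid.pullFracModel φ)



/-- **No square root downstairs**: the uniformiser `t = 1·t¹ ∈ O^×(A_⊙^birat) = ℂˣ × t^ℤ` of the integral toy has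
no square root (`2k = 1` is insoluble in `ℤ`), although — `exists_pow_eq_pullFracModel_cover` — its pull-back
`t²` along the degree-`2` Kummer cover does: at `ToyCovZ` the roots demanded by Prop 4.2 (iii) exist ONLY after
passing to the covering (ERRATUM E2). [cite: MochizukiEtTh2009, Prop 4.2 p.89] -/
theorem roots_only_upstairs :
    ∃ f : temperedFrobenioid.biratUnitsModel Aodot,
      (¬ ∃ g : temperedFrobenioid.biratUnitsModel Aodot, g ^ 2 = f) ∧
        ∃ g : temperedFrobenioid.biratUnitsModel Aodot, g ^ ((2 : ℕ+) : ℕ) =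
          temperedFrobenioid.pullFracModel
            (ModelFrobenioid.mkHom Aodot Aodot 1 (cover Aodot.base Aodot.base 2) 1 1 (cover_rel 2)) f := by
  let z : temperedFrobenioid.divisorMonoid.obj (op Aodot.base) := ⟨Multiplicative.ofAdd (1 : ℚ≥0), trivial⟩
  have hz : realified.divΛ (temperedFrobenioid.baseOp (op Aodot.base))
      (((1 : ℂˣ), Multiplicative.ofAdd (1 : ℤ)) : Fn) =
      temperedFrobenioid.ΦgpToRlog (op Aodot.base) (Algebra.GrothendieckGroup.of z) := by
    change Toy.divHomQ (Multiplicative.ofAdd 1) = gpMap _ (Algebra.GrothendieckGroup.of z)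
    rw [Toy.divHomQ_ofAdd_one, gpMap_of]
    rfl
  let t : temperedFrobenioid.ratFnFunctor.obj (op Aodot.base) :=
    ⟨(((1 : ℂˣ), Multiplicative.ofAdd (1 : ℤ)), Algebra.GrothendieckGroup.of z), hz⟩
  let π : temperedFrobenioid.biratUnitsModel Aodot →* Multiplicative ℤ :=
    (MonoidHom.snd ℂˣ (Multiplicative ℤ)).comp ((MonoidHom.fst _ _).comp
      ((temperedFrobenioid.ratFn (op Aodot.base)).subtype.comp (Units.coeHom _)))
  refine ⟨(temperedFrobenioid.isUnit_ratFnFunctor realified.isUnit_BΛ Aodot t).unit, ?_,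
    exists_pow_eq_pullFracModel_cover 2 _⟩
  rintro ⟨g, hg⟩
  have hπt : π (temperedFrobenioid.isUnit_ratFnFunctor realified.isUnit_BΛ Aodot t).unit =
      Multiplicative.ofAdd (1 : ℤ) := by
    change ((temperedFrobenioid.isUnit_ratFnFunctor realified.isUnit_BΛ Aodot t).unit :
      temperedFrobenioid.ratFnFunctor.obj (op Aodot.base)).1.1.2 = _
    rw [IsUnit.unit_spec]
  have h : π g ^ 2 = Multiplicative.ofAdd (1 : ℤ) := by rw [← map_pow, hg, hπt]
  have h2 := congrArg Multiplicative.toAdd h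
  rw [toAdd_pow, toAdd_ofAdd, nsmul_eq_mul] at h2
  omega

/-- **Props 4.2 (i)–(iv) and 4.3 (ii)(iii) hold simultaneously at the integral Kummer-tower toy**, where roots
exist only upstairs. [cite: MochizukiEtTh2009, Prop 4.2 p.88] -/
theorem sec4_props_roots_upstairs :
    (∃ f : temperedFrobenioid.biratUnitsModel Aodot, ¬ ∃ g : temperedFrobenioid.biratUnitsModel Aodot, g ^ 2 = f) ∧
      BiKummerSetting.Prop42Sub.RootOverCovering biKummerSetting
        (fun {_ _} φ x => temperedFrobenioid.pullFracModel φ x) ∧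
      biKummerSetting.Prop42_i ∧ biKummerSetting.Prop42_ii ∧
      biKummerSetting.Prop42_iii (fun {_ _} φ x => temperedFrobenioid.pullFracModel φ x) ∧
      biKummerSetting.Prop42_iv (fun φ x => temperedFrobenioid.pullFracModel φ x) ∧
      (biKummerSetting.Prop43_ii fun {_ _} φ => temperedFrobenioid.pullFracModel φ) ∧
      (biKummerSetting.Prop43_iii fun {_ _} φ => temperedFrobenioid.pullFracModel φ) :=
  ⟨(roots_only_upstairs.imp fun _ h => h.1), rootOverCovering, prop42_i_and_ii.1, prop42_i_and_ii.2, prop42_iii,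
    prop42_iv, prop43_ii, prop43_iii⟩


/-- **The covering rows of the sub-DAG at the integral toy**: L01′ `SaturatedRootCoverInSkeleton`, L01a
`RootOverCovering` and L01b `SaturatedRefinement` hold SIMULTANEOUSLY at `ToyCovZ` (roots taken upstairs along
the Kummer cover). [cite: MochizukiEtTh2009, Prop 4.2 p.89] -/
theorem covering_rows :
    BiKummerSetting.Prop42Sub.SaturatedRootCoverInSkeleton biKummerSetting
        (fun {_ _} φ x => temperedFrobenioid.pullFracModel φ x) ∧
      BiKummerSetting.Prop42Sub.RootOverCovering biKummerSetting
        (fun {_ _} φ x => temperedFrobenioid.pullFracModel φ x) ∧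
      BiKummerSetting.Prop42Sub.SaturatedRefinement biKummerSetting
        (fun {_ _} φ x => temperedFrobenioid.pullFracModel φ x) :=
  ⟨saturatedRootCoverInSkeleton, rootOverCovering, saturatedRefinement⟩

/-- **L05 and Prop 4.2 (iv) at the integral toy**, simultaneously. [cite: MochizukiEtTh2009, Prop 4.2 p.90] -/
theorem unitRoots_and_prop42_iv :
    BiKummerSetting.Prop42Sub.UnitRootsUpstairs biKummerSetting (fun φ x => temperedFrobenioid.pullFracModel φ x) ∧
      biKummerSetting.Prop42_iv (fun φ x => temperedFrobenioid.pullFracModel φ x) :=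
  ⟨unitRootsUpstairs, prop42_iv⟩

end Roots

end ToyCovZ

end Literature.AnabelianGeometry.EtaleTheta

end
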